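import Mathlib
import Summits.ValiantsHypothesis.ValiantsHypothesis.Theses.GeneratorObstructions
import Summits.ValiantsHypothesis.ValiantsHypothesis.Theorems.GeneratorObstructionsPowGenDegreeQPRowOne
import Summits.ValiantsHypothesis.ValiantsHypothesis.Theorems.GeneratorObstructionsPowGenDegreeQPCholeskyDensity

/-!
# K2 `PowGenDegreeQP` (stmt-ValiantsHypothesis-11655), line `trace-side-regimes`:
# the row `m = 2` (quadrics) of the window is CLOSED; K2 and both registered stubs are equivalent
# to their restrictions to the rows `m ≥ 3`

Helper file (`--supports stmt-ValiantsHypothesis-11655`).  Assembly of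
`…RowTwoReduction.rowTwo_bound_of_sign_of_fund` (structure: Borel-dense point with sign symmetries
and fundamental even weights ⇒ generator types are `0` or `-2·𝟙_{≥t}`) with its three inputs, all
now discharged for `f = tr X_n²` over `ℂ`: (i) `h₀ · tr X_n² = ∑ c_u X_u²` and `hsign`
(`…TraceTwoDiagonal`), `hfund` (`…QuadricGram`: principal minors of the Gram matrix on final segments
are highest-weight vectors), `hdense` (`…CholeskyDensity`: Cholesky density of the Borel orbit).

* `powGenDegreeQP_rowTwo` — the body of the route decl `PowGenDegreeQP` at `m = 2`, for every `c`
  and `e` in the window, with exponent `c₀ = c + 1`: every generator type `χ` of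
  `A(Δ_2(tr X_{2+e}²))` has `-|χ| ≤ 2 · 2^((log₂ 2 + (c+1))^(c+1))` (in fact `-|χ| ≤ 2 (2+e)²`);
* `stub_sliceGen_rowTwo`, `stub_wideGen_rowTwo` — the registered stub bodies at `m = 2`;
* `powGenDegreeQP_iff_three_le`, `stub_sliceGen_iff_three_le`, `stub_wideGen_iff_three_le` — the
  route decl K2 (verbatim) and each registered stub (verbatim body) are EQUIVALENT to the same
  statement with `1 ≤ m` strengthened to `3 ≤ m` (rows `m = 1`: `…RowOne`; `m = 2`: this file).
  A lead may therefore restate either stub to `3 ≤ m` without loss.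

Honest label: the two bottom rows of the window are closed (linear forms; quadrics =
`k[Sym²]^U = k[Δ_1,…,Δ_N]`, Goodman–Wallach §5.7 / Vinberg–Kimel'fel'd); rows `m ≥ 3` (cubics and
beyond, where `Δ_m(tr X_n^m)` is not spherical) of both registered stubs remain OPEN — they are the
research-level content of K2.
-/

namespace Summit.ValiantsHypothesis.ValiantsHypothesis.Theorems.GeneratorObstructions.PowGenDegreeQP

open MvPolynomial
open Literature.NumberTheory.DiophantineGeometry Literature.Computability.AlgebraicComplexity
open Summit.ValiantsHypothesis.ValiantsHypothesis.Theses.GeneratorObstructions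

-- `Summit.ValiantsHypothesis.ValiantsHypothesis.…` is the tree's mandated single-conjunct layout.
set_option linter.dupNamespace false

noncomputable section

/-! ## 1. The row `m = 2` -/

/-- **Row `m = 2` of K2 CLOSED**: for every `c`, `e` with `2 + e ≤ 2^((log₂ 2 + c)^c)` and every
generator type `χ` of `A(Δ_2(tr X_{2+e}²))`, `-|χ| ≤ 2 · 2^((log₂ 2 + (c+1))^(c+1))` — the body of
`PowGenDegreeQP` at `m = 2` with exponent `c₀ = c + 1`. [folklore] -/
theorem powGenDegreeQP_rowTwo (c e : ℕ) (hwin : 2 + e ≤ 2 ^ ((Nat.log 2 2 + c) ^ c))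
    (χ : Weight (MatIdx (2 + e)))
    (hγ : Module.finrank ℂ
      (↥(highestWeightSpace (orbitCoordRep (powFormLex ℂ (2 + e) 2) 2) χ) ⧸
        Submodule.comap (highestWeightSpace (orbitCoordRep (powFormLex ℂ (2 + e) 2) 2) χ).subtype
          (⨆ p : Weight (MatIdx (2 + e)) × Weight (MatIdx (2 + e)),
            ⨆ (_ : p.1 + p.2 = χ ∧ p.1 ≠ 0 ∧ p.2 ≠ 0),
              highestWeightSpace (orbitCoordRep (powFormLex ℂ (2 + e) 2) 2) p.1 *
                highestWeightSpace (orbitCoordRep (powFormLex ℂ (2 + e) 2) 2) p.2)) ≠ 0) :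
    -(Weight.size χ) ≤ ((2 : ℕ) : ℤ) * 2 ^ ((Nat.log 2 2 + (c + 1)) ^ (c + 1)) := by
  obtain ⟨h₀, hh₀⟩ := exists_gl_powFormLex_two_eq_diagonal ℂ (2 + e)
  exact rowTwo_bound_of_dense c e h₀ hh₀ (hdense_powFormLex_two (2 + e) h₀ hh₀) hwin χ hγ

/-- **`stub_sliceGen`, row `m = 2`**: slice generator types `ext_ι χ` of `A(Δ_2(tr X_{2+e}²))` obey the
K2 bound with exponent `c + 1` (registered stub body at `m = 2`). [folklore] -/
theorem stub_sliceGen_rowTwo (c e : ℕ) (hwin : 2 + e ≤ 2 ^ ((Nat.log 2 2 + c) ^ c))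
    (ι : MatIdx 2 → MatIdx (2 + e)) (hι : StrictMono ι) (χ : Weight (MatIdx 2))
    (hγ : Module.finrank ℂ
      (↥(highestWeightSpace (orbitCoordRep (powFormLex ℂ (2 + e) 2) 2) (Function.extend ι χ 0)) ⧸
        Submodule.comap
          (highestWeightSpace (orbitCoordRep (powFormLex ℂ (2 + e) 2) 2) (Function.extend ι χ 0)).subtype
          (⨆ p : Weight (MatIdx (2 + e)) × Weight (MatIdx (2 + e)),
            ⨆ (_ : p.1 + p.2 = (Function.extend ι χ 0) ∧ p.1 ≠ 0 ∧ p.2 ≠ 0),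
              highestWeightSpace (orbitCoordRep (powFormLex ℂ (2 + e) 2) 2) p.1 *
                highestWeightSpace (orbitCoordRep (powFormLex ℂ (2 + e) 2) 2) p.2)) ≠ 0) :
    -(Weight.size χ) ≤ ((2 : ℕ) : ℤ) * 2 ^ ((Nat.log 2 2 + (c + 1)) ^ (c + 1)) := by
  rw [← Summit.ValiantsHypothesis.ValiantsHypothesis.Theorems.GenInheritance.size_extend hι.injective χ]
  exact powGenDegreeQP_rowTwo c e hwin _ hγ

/-- **`stub_wideGen`, row `m = 2`**: wide generator types of `A(Δ_2(tr X_{2+e}²))` obey the K2 bound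
with exponent `c + 1` (registered stub body at `m = 2`; the wideness hypothesis is not needed).
[folklore] -/
theorem stub_wideGen_rowTwo (c e : ℕ) (hwin : 2 + e ≤ 2 ^ ((Nat.log 2 2 + c) ^ c))
    (χ : Weight (MatIdx (2 + e)))
    (hγ : Module.finrank ℂ
      (↥(highestWeightSpace (orbitCoordRep (powFormLex ℂ (2 + e) 2) 2) χ) ⧸
        Submodule.comap (highestWeightSpace (orbitCoordRep (powFormLex ℂ (2 + e) 2) 2) χ).subtype
          (⨆ p : Weight (MatIdx (2 + e)) × Weight (MatIdx (2 + e)),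
            ⨆ (_ : p.1 + p.2 = χ ∧ p.1 ≠ 0 ∧ p.2 ≠ 0),
              highestWeightSpace (orbitCoordRep (powFormLex ℂ (2 + e) 2) 2) p.1 *
                highestWeightSpace (orbitCoordRep (powFormLex ℂ (2 + e) 2) 2) p.2)) ≠ 0) :
    -(Weight.size χ) ≤ ((2 : ℕ) : ℤ) * 2 ^ ((Nat.log 2 2 + (c + 1)) ^ (c + 1)) :=
  powGenDegreeQP_rowTwo c e hwin χ hγ

/-! ## 2. K2 and the stubs from their rows `m ≥ 3` -/

/-- Monotonicity of the K2 bound `m · 2^((log₂ m + c)^c)` in the exponent `c`. [folklore] -/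
theorem bound_mono_of_le (m : ℕ) {c c' : ℕ} (h : c ≤ c') :
    (m : ℤ) * 2 ^ ((Nat.log 2 m + c) ^ c) ≤ (m : ℤ) * 2 ^ ((Nat.log 2 m + c') ^ c') := by
  have hmono : (Nat.log 2 m + c) ^ c ≤ (Nat.log 2 m + c') ^ c' := by
    rcases Nat.eq_zero_or_pos (Nat.log 2 m + c') with h0 | hpos
    · have hc' : c' = 0 := by omega
      have hc : c = 0 := by omega
      subst hc'; subst hc; simp
    · exact (Nat.pow_le_pow_left (by omega) c).trans (Nat.pow_le_pow_right hpos h)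
  exact mul_le_mul_of_nonneg_left (pow_le_pow_right₀ (by norm_num) hmono) (by positivity)

/-- **K2 ⟺ K2 on the rows `m ≥ 3`.** The route decl `PowGenDegreeQP` (verbatim) is equivalent to
the same window statement with `3 ≤ m` in place of `1 ≤ m` (rows `m = 1`, `m = 2` closed by
`powGenDegreeQP_rowOne`, `powGenDegreeQP_rowTwo`; exponent `max (c+1) c₀`; cf. `powGenDegreeQP_iff_two_le`).
[folklore] -/
theorem powGenDegreeQP_iff_three_le :
    PowGenDegreeQP ↔
      ∀ c : ℕ, ∃ c₀ : ℕ, ∀ m e : ℕ, 3 ≤ m → m + e ≤ 2 ^ ((Nat.log 2 m + c) ^ c) →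
        ∀ χ : Weight (MatIdx (m + e)),
          Module.finrank ℂ (↥(highestWeightSpace (orbitCoordRep (powFormLex ℂ (m + e) m) m) χ) ⧸
            Submodule.comap (highestWeightSpace (orbitCoordRep (powFormLex ℂ (m + e) m) m) χ).subtype
              (⨆ p : Weight (MatIdx (m + e)) × Weight (MatIdx (m + e)),
                ⨆ (_ : p.1 + p.2 = χ ∧ p.1 ≠ 0 ∧ p.2 ≠ 0),
                  highestWeightSpace (orbitCoordRep (powFormLex ℂ (m + e) m) m) p.1 *
                    highestWeightSpace (orbitCoordRep (powFormLex ℂ (m + e) m) m) p.2)) ≠ 0 →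
          -(Weight.size χ) ≤ (m : ℤ) * 2 ^ ((Nat.log 2 m + c₀) ^ c₀) := by
  unfold PowGenDegreeQP
  constructor
  · intro h c
    obtain ⟨c₀, hc₀⟩ := h c
    exact ⟨c₀, fun m e hm he χ hγ => hc₀ m e (by omega) he χ hγ⟩
  · intro h c
    obtain ⟨c₀, hc₀⟩ := h c
    refine ⟨max (c + 1) c₀, fun m e hm he χ hγ => ?_⟩
    rcases Nat.lt_or_ge m 3 with hm3 | hm3
    · rcases Nat.lt_or_ge m 2 with hm2 | hm2
      · obtain rfl : m = 1 := by omega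
        exact powGenDegreeQP_rowOne _ e χ hγ
      · obtain rfl : m = 2 := by omega
        exact (powGenDegreeQP_rowTwo c e he χ hγ).trans (bound_mono_of_le 2 (le_max_left _ _))
    · exact (hc₀ m e hm3 he χ hγ).trans (bound_mono_of_le m (le_max_right _ _))

/-- **`stub_sliceGen` ⟺ `stub_sliceGen` on the rows `m ≥ 3`** (registered stub of
`Lines/trace_side_regimes.lean`, verbatim body on the left). [folklore] -/
theorem stub_sliceGen_iff_three_le :
    (∀ c : ℕ, ∃ c₀ : ℕ, ∀ m e : ℕ, 1 ≤ m → m + e ≤ 2 ^ ((Nat.log 2 m + c) ^ c) →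
      ∀ ι : MatIdx m → MatIdx (m + e), StrictMono ι → IsUpperSet (Set.range ι) →
        ∀ χ : Weight (MatIdx m),
          Module.finrank ℂ (↥(highestWeightSpace (orbitCoordRep (powFormLex ℂ (m + e) m) m) (Function.extend ι χ 0)) ⧸ Submodule.comap (highestWeightSpace (orbitCoordRep (powFormLex ℂ (m + e) m) m) (Function.extend ι χ 0)).subtype (⨆ p : Weight (MatIdx (m + e)) × Weight (MatIdx (m + e)), ⨆ (_ : p.1 + p.2 = (Function.extend ι χ 0) ∧ p.1 ≠ 0 ∧ p.2 ≠ 0), highestWeightSpace (orbitCoordRep (powFormLex ℂ (m + e) m) m) p.1 * highestWeightSpace (orbitCoordRep (powFormLex ℂ (m + e) m) m) p.2)) ≠ 0 →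
            -(Weight.size χ) ≤ (m : ℤ) * 2 ^ ((Nat.log 2 m + c₀) ^ c₀)) ↔
    (∀ c : ℕ, ∃ c₀ : ℕ, ∀ m e : ℕ, 3 ≤ m → m + e ≤ 2 ^ ((Nat.log 2 m + c) ^ c) →
      ∀ ι : MatIdx m → MatIdx (m + e), StrictMono ι → IsUpperSet (Set.range ι) →
        ∀ χ : Weight (MatIdx m),
          Module.finrank ℂ (↥(highestWeightSpace (orbitCoordRep (powFormLex ℂ (m + e) m) m) (Function.extend ι χ 0)) ⧸ Submodule.comap (highestWeightSpace (orbitCoordRep (powFormLex ℂ (m + e) m) m) (Function.extend ι χ 0)).subtype (⨆ p : Weight (MatIdx (m + e)) × Weight (MatIdx (m + e)), ⨆ (_ : p.1 + p.2 = (Function.extend ι χ 0) ∧ p.1 ≠ 0 ∧ p.2 ≠ 0), highestWeightSpace (orbitCoordRep (powFormLex ℂ (m + e) m) m) p.1 * highestWeightSpace (orbitCoordRep (powFormLex ℂ (m + e) m) m) p.2)) ≠ 0 →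
            -(Weight.size χ) ≤ (m : ℤ) * 2 ^ ((Nat.log 2 m + c₀) ^ c₀)) := by
  constructor
  · intro h c
    obtain ⟨c₀, hc₀⟩ := h c
    exact ⟨c₀, fun m e hm he ι hι hup χ hγ => hc₀ m e (by omega) he ι hι hup χ hγ⟩
  · intro h c
    obtain ⟨c₀, hc₀⟩ := h c
    refine ⟨max (c + 1) c₀, fun m e hm he ι hι hup χ hγ => ?_⟩
    rcases Nat.lt_or_ge m 3 with hm3 | hm3
    · rcases Nat.lt_or_ge m 2 with hm2 | hm2
      · obtain rfl : m = 1 := by omega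
        exact stub_sliceGen_rowOne _ e ι hι χ hγ
      · obtain rfl : m = 2 := by omega
        exact (stub_sliceGen_rowTwo c e he ι hι χ hγ).trans (bound_mono_of_le 2 (le_max_left _ _))
    · exact (hc₀ m e hm3 he ι hι hup χ hγ).trans (bound_mono_of_le m (le_max_right _ _))

/-- **`stub_wideGen` ⟺ `stub_wideGen` on the rows `m ≥ 3`** (registered stub of
`Lines/trace_side_regimes.lean`, verbatim body on the left). [folklore] -/
theorem stub_wideGen_iff_three_le :
    (∀ c : ℕ, ∃ c₀ : ℕ, ∀ m e : ℕ, 1 ≤ m → m + e ≤ 2 ^ ((Nat.log 2 m + c) ^ c) →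
      ∀ ι : MatIdx m → MatIdx (m + e), StrictMono ι → IsUpperSet (Set.range ι) →
        ∀ χ : Weight (MatIdx (m + e)), (∃ x, x ∉ Set.range ι ∧ χ x ≠ 0) →
          Module.finrank ℂ (↥(highestWeightSpace (orbitCoordRep (powFormLex ℂ (m + e) m) m) (χ)) ⧸ Submodule.comap (highestWeightSpace (orbitCoordRep (powFormLex ℂ (m + e) m) m) (χ)).subtype (⨆ p : Weight (MatIdx (m + e)) × Weight (MatIdx (m + e)), ⨆ (_ : p.1 + p.2 = (χ) ∧ p.1 ≠ 0 ∧ p.2 ≠ 0), highestWeightSpace (orbitCoordRep (powFormLex ℂ (m + e) m) m) p.1 * highestWeightSpace (orbitCoordRep (powFormLex ℂ (m + e) m) m) p.2)) ≠ 0 →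
            -(Weight.size χ) ≤ (m : ℤ) * 2 ^ ((Nat.log 2 m + c₀) ^ c₀)) ↔
    (∀ c : ℕ, ∃ c₀ : ℕ, ∀ m e : ℕ, 3 ≤ m → m + e ≤ 2 ^ ((Nat.log 2 m + c) ^ c) →
      ∀ ι : MatIdx m → MatIdx (m + e), StrictMono ι → IsUpperSet (Set.range ι) →
        ∀ χ : Weight (MatIdx (m + e)), (∃ x, x ∉ Set.range ι ∧ χ x ≠ 0) →
          Module.finrank ℂ (↥(highestWeightSpace (orbitCoordRep (powFormLex ℂ (m + e) m) m) (χ)) ⧸ Submodule.comap (highestWeightSpace (orbitCoordRep (powFormLex ℂ (m + e) m) m) (χ)).subtype (⨆ p : Weight (MatIdx (m + e)) × Weight (MatIdx (m + e)), ⨆ (_ : p.1 + p.2 = (χ) ∧ p.1 ≠ 0 ∧ p.2 ≠ 0), highestWeightSpace (orbitCoordRep (powFormLex ℂ (m + e) m) m) p.1 * highestWeightSpace (orbitCoordRep (powFormLex ℂ (m + e) m) m) p.2)) ≠ 0 →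
            -(Weight.size χ) ≤ (m : ℤ) * 2 ^ ((Nat.log 2 m + c₀) ^ c₀)) := by
  constructor
  · intro h c
    obtain ⟨c₀, hc₀⟩ := h c
    exact ⟨c₀, fun m e hm he ι hι hup χ hw hγ => hc₀ m e (by omega) he ι hι hup χ hw hγ⟩
  · intro h c
    obtain ⟨c₀, hc₀⟩ := h c
    refine ⟨max (c + 1) c₀, fun m e hm he ι hι hup χ hw hγ => ?_⟩
    rcases Nat.lt_or_ge m 3 with hm3 | hm3
    · rcases Nat.lt_or_ge m 2 with hm2 | hm2
      · obtain rfl : m = 1 := by omega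
        exact stub_wideGen_rowOne _ e ι hup χ hw hγ
      · obtain rfl : m = 2 := by omega
        exact (stub_wideGen_rowTwo c e he χ hγ).trans (bound_mono_of_le 2 (le_max_left _ _))
    · exact (hc₀ m e hm3 he ι hι hup χ hw hγ).trans (bound_mono_of_le m (le_max_right _ _))

/-- **K2 from its rows `m ≥ 3`** (the usable direction, as an implication). [folklore] -/
theorem powGenDegreeQP_of_three_le
    (h : ∀ c : ℕ, ∃ c₀ : ℕ, ∀ m e : ℕ, 3 ≤ m → m + e ≤ 2 ^ ((Nat.log 2 m + c) ^ c) →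
        ∀ χ : Weight (MatIdx (m + e)),
          Module.finrank ℂ (↥(highestWeightSpace (orbitCoordRep (powFormLex ℂ (m + e) m) m) χ) ⧸
            Submodule.comap (highestWeightSpace (orbitCoordRep (powFormLex ℂ (m + e) m) m) χ).subtype
              (⨆ p : Weight (MatIdx (m + e)) × Weight (MatIdx (m + e)),
                ⨆ (_ : p.1 + p.2 = χ ∧ p.1 ≠ 0 ∧ p.2 ≠ 0),
                  highestWeightSpace (orbitCoordRep (powFormLex ℂ (m + e) m) m) p.1 *
                    highestWeightSpace (orbitCoordRep (powFormLex ℂ (m + e) m) m) p.2)) ≠ 0 →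
          -(Weight.size χ) ≤ (m : ℤ) * 2 ^ ((Nat.log 2 m + c₀) ^ c₀)) :
    PowGenDegreeQP :=
  powGenDegreeQP_iff_three_le.mpr h

end

end Summit.ValiantsHypothesis.ValiantsHypothesis.Theorems.GeneratorObstructions.PowGenDegreeQP
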